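import Summits.Ventures.LatticeQCDFlow.Scaling.SchwingerDysonIdentities

/-!
# SchwingerDysonField — `|∇ₑS|²`, `ΔₑS`, `Φₑ = β|∇ₑS|² − ΔₑS` FOR A FAMILY OF DIRECTIONS: `E_β[GΦₑ] =
# Σ_a E_β[∂_aG ∂_aS]`, `E_β[Φₑ] = 0`, ORTHOGONALITY FOR NON-INTERACTING LINKS, `E_β[Φₑ²] ≤ B` UNIFORMLY IN
# `β` (theory2 item 127, PART 2 of 3: §3)

HONEST FRAMING: exact (Metropolis-corrected) sampling algorithms for lattice gauge theory;
figures of merit are autocorrelation/cost numbers at stated couplings and volumes; no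
continuum-physics claim.

CUSTODY: theory2 item 127 (GEN-40, HOME tier) re-landed by lean-2 GEN-9 per LEAD LINE 245 RT-30 (202);
statements and proofs = HOME/lean/theory2/SchwingerDysonVarianceFloor.lean a9784aeca1b7b122 (853 l)
verbatim, split below the `lint.size` line into THREE files (`SchwingerDysonIdentities` §0–§2,
`SchwingerDysonField` §3, `SchwingerDysonVarianceFloor` §4); headers trimmed; docstrings added where the
lint asks.

This part (§3): for a finite family of directions `Y : ι → 𝔰𝔲(n)` and a link `e`, `|∇ₑS|² = Σ_a (∂_a S)²`
(`sqGrad`), `Δₑ S = Σ_a ∂_a∂_a S` (`dirLap`), `Φₑ = β|∇ₑS|² − ΔₑS` (`sdField`); the DIRICHLET IDENTITY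
`E_β[G Φₑ] = Σ_a E_β[∂_aG ∂_aS]` (`integral_mul_sdField`); consequences `E_β[Φₑ] = 0`,
`E_β[S Φₑ] = E_β|∇ₑS|² = β⁻¹ E_β[ΔₑS]`; for two links with no mixed derivatives of `S`,
`E_β[Φₑ Φₑ'] = 0` (`integral_sdField_mul_sdField_eq_zero`); and `E_β[Φₑ²] ≤ k²(2c₂² + c₁c₃) =: B`
UNIFORMLY IN `β > 0` from sup bounds on the first three `e`-derivatives of `S`
(`integral_sdField_sq_mul_weight_le`).
-/

noncomputable section

set_option linter.unusedSectionVars false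

namespace Summit.Ventures.LatticeQCDFlow.Theory2.SchwingerDyson

open MeasureTheory ProbabilityTheory
open Literature.MathematicalPhysics.QuantumFieldTheory
open Literature.MathematicalPhysics.QuantumFieldTheory.Luscher2010
open Literature.MathematicalPhysics.QuantumFieldTheory.WilsonFlow (coeConfig continuous_coeConfig)
open Summit.Ventures.LatticeQCDFlow.TrivializingMaps
open scoped Matrix Matrix.Norms.Frobenius ContDiff

variable {d L n : ℕ} [NeZero L]

/-! ## §3. A family of directions: `|∇ₑS|²`, `ΔₑS`, `Φₑ = β|∇ₑS|² − ΔₑS` -/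

section Family

variable {ι : Type*} [Fintype ι]

/-- `|∇ₑS|²(W) = Σ_a (∂_{e,Y a} S(W))²`. -/
def sqGrad (Y : ι → Matrix (Fin n) (Fin n) ℂ) (S : AmbConfig d L n → ℝ) (e : Edge d L)
    (W : AmbConfig d L n) : ℝ :=
  ∑ a, linkDeriv e (Y a) S W ^ 2

/-- The directional Laplacian `ΔₑS(W) = Σ_a ∂_{e,Y a}∂_{e,Y a} S(W)` (no sign, any family `Y`). -/
def dirLap (Y : ι → Matrix (Fin n) (Fin n) ℂ) (S : AmbConfig d L n → ℝ) (e : Edge d L)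
    (W : AmbConfig d L n) : ℝ :=
  ∑ a, linkDeriv e (Y a) (linkDeriv e (Y a) S) W

/-- One term of the Schwinger–Dyson field: `β(∂_b S)² − ∂_b∂_b S`. -/
def sdTerm (Y : ι → Matrix (Fin n) (Fin n) ℂ) (S : AmbConfig d L n → ℝ) (β : ℝ) (e : Edge d L)
    (b : ι) (W : AmbConfig d L n) : ℝ :=
  β * linkDeriv e (Y b) S W ^ 2 - linkDeriv e (Y b) (linkDeriv e (Y b) S) W

/-- The Schwinger–Dyson field of the link `e`: `Φₑ = β|∇ₑS|² − ΔₑS`. -/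
def sdField (Y : ι → Matrix (Fin n) (Fin n) ℂ) (S : AmbConfig d L n → ℝ) (β : ℝ) (e : Edge d L)
    (W : AmbConfig d L n) : ℝ :=
  β * sqGrad Y S e W - dirLap Y S e W

variable {Y : ι → Matrix (Fin n) (Fin n) ℂ} {S G : AmbConfig d L n → ℝ}

/-- `Φₑ` as a sum over the directions. [folklore] -/
theorem sdField_eq_sum (Y : ι → Matrix (Fin n) (Fin n) ℂ) (S : AmbConfig d L n → ℝ) (β : ℝ)
    (e : Edge d L) : sdField Y S β e = fun W => ∑ b, sdTerm Y S β e b W := by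
  funext W
  unfold sdField sqGrad dirLap sdTerm
  rw [Finset.mul_sum, ← Finset.sum_sub_distrib]

/-- `|∇ₑS|²` is smooth. [folklore] -/
theorem contDiff_sqGrad (hS : ContDiff ℝ ∞ S) (Y : ι → Matrix (Fin n) (Fin n) ℂ) (e : Edge d L) :
    ContDiff ℝ ∞ (sqGrad Y S e) := by
  unfold sqGrad
  exact ContDiff.sum fun a _ => (contDiff_linkDeriv hS e (Y a)).pow 2

/-- `ΔₑS` is smooth. [folklore] -/
theorem contDiff_dirLap (hS : ContDiff ℝ ∞ S) (Y : ι → Matrix (Fin n) (Fin n) ℂ) (e : Edge d L) :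
    ContDiff ℝ ∞ (dirLap Y S e) := by
  unfold dirLap
  exact ContDiff.sum fun a _ => contDiff_linkDeriv (contDiff_linkDeriv hS e (Y a)) e (Y a)

/-- `sdTerm` is smooth. [folklore] -/
theorem contDiff_sdTerm (hS : ContDiff ℝ ∞ S) (Y : ι → Matrix (Fin n) (Fin n) ℂ) (β : ℝ)
    (e : Edge d L) (b : ι) : ContDiff ℝ ∞ (sdTerm Y S β e b) := by
  unfold sdTerm
  exact (contDiff_const.mul ((contDiff_linkDeriv hS e (Y b)).pow 2)).sub
    (contDiff_linkDeriv (contDiff_linkDeriv hS e (Y b)) e (Y b))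

/-- `Φₑ` is smooth. [folklore] -/
theorem contDiff_sdField (hS : ContDiff ℝ ∞ S) (Y : ι → Matrix (Fin n) (Fin n) ℂ) (β : ℝ)
    (e : Edge d L) : ContDiff ℝ ∞ (sdField Y S β e) := by
  unfold sdField
  exact (contDiff_const.mul (contDiff_sqGrad hS Y e)).sub (contDiff_dirLap hS Y e)

/-- **Dirichlet identity**: `∫ G·Φₑ·w = Σ_a ∫ ∂_aG·∂_aS·w`. [folklore] -/
theorem integral_mul_sdField (hS : ContDiff ℝ ∞ S) (hG : ContDiff ℝ ∞ G)
    (hY : ∀ a, Y a ∈ suAlgebra n) (β : ℝ) (e : Edge d L) :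
    ∫ U, G (coeConfig U) * sdField Y S β e (coeConfig U) * weight S β U
        ∂(trivialMeasure (Matrix.specialUnitaryGroup (Fin n) ℂ) d L) =
      ∑ a, ∫ U, linkDeriv e (Y a) G (coeConfig U) * linkDeriv e (Y a) S (coeConfig U) *
        weight S β U ∂(trivialMeasure (Matrix.specialUnitaryGroup (Fin n) ℂ) d L) := by
  have hpt : (fun U : GaugeConfig d L (Matrix.specialUnitaryGroup (Fin n) ℂ) =>
      G (coeConfig U) * sdField Y S β e (coeConfig U) * weight S β U) = fun U =>
      ∑ a, G (coeConfig U) * (β * linkDeriv e (Y a) S (coeConfig U) ^ 2 -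
        linkDeriv e (Y a) (linkDeriv e (Y a) S) (coeConfig U)) * weight S β U := by
    funext U
    unfold sdField sqGrad dirLap
    rw [Finset.mul_sum, ← Finset.sum_sub_distrib, Finset.mul_sum, Finset.sum_mul]
  rw [hpt, integral_finsetSum _ (fun a _ => ?_)]
  · exact Finset.sum_congr rfl fun a _ => dirichlet_identity hS hG β e (hY a)
  · exact integrable_mul_weight hS β (hG.mul (contDiff_sdTerm hS Y β e a))

/-- `E[Φₑ] = 0`: `∫ Φₑ·w = 0`. [folklore] -/
theorem integral_sdField_mul_weight (hS : ContDiff ℝ ∞ S) (hY : ∀ a, Y a ∈ suAlgebra n) (β : ℝ)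
    (e : Edge d L) :
    ∫ U, sdField Y S β e (coeConfig U) * weight S β U
        ∂(trivialMeasure (Matrix.specialUnitaryGroup (Fin n) ℂ) d L) = 0 := by
  have h : ∫ U, (1 : ℝ) * sdField Y S β e (coeConfig U) * weight S β U
        ∂(trivialMeasure (Matrix.specialUnitaryGroup (Fin n) ℂ) d L) =
      ∑ a, ∫ U, linkDeriv e (Y a) (fun _ => (1 : ℝ)) (coeConfig U) *
        linkDeriv e (Y a) S (coeConfig U) * weight S β U
        ∂(trivialMeasure (Matrix.specialUnitaryGroup (Fin n) ℂ) d L) :=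
    integral_mul_sdField hS contDiff_const hY β e
  have hz : ∀ a (W : AmbConfig d L n), linkDeriv e (Y a) (fun _ => (1 : ℝ)) W = 0 := by
    intro a W
    simp [linkDeriv]
  simp only [one_mul, hz, zero_mul, integral_zero, Finset.sum_const_zero] at h
  exact h

/-- `β·E|∇ₑS|² = E[ΔₑS]`: `β ∫ |∇ₑS|²·w = ∫ ΔₑS·w`. [folklore] -/
theorem integral_dirLap_mul_weight (hS : ContDiff ℝ ∞ S) (hY : ∀ a, Y a ∈ suAlgebra n) (β : ℝ)
    (e : Edge d L) :
    β * ∫ U, sqGrad Y S e (coeConfig U) * weight S β U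
        ∂(trivialMeasure (Matrix.specialUnitaryGroup (Fin n) ℂ) d L) =
      ∫ U, dirLap Y S e (coeConfig U) * weight S β U
        ∂(trivialMeasure (Matrix.specialUnitaryGroup (Fin n) ℂ) d L) := by
  have h := integral_sdField_mul_weight hS hY β e
  have hpt : (fun U : GaugeConfig d L (Matrix.specialUnitaryGroup (Fin n) ℂ) =>
      sdField Y S β e (coeConfig U) * weight S β U) = fun U =>
      β * (sqGrad Y S e (coeConfig U) * weight S β U) - dirLap Y S e (coeConfig U) * weight S β U := by
    funext U; unfold sdField; ring
  rw [hpt, integral_sub ((integrable_mul_weight hS β (contDiff_sqGrad hS Y e)).const_mul β)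
    (integrable_mul_weight hS β (contDiff_dirLap hS Y e)), integral_const_mul, sub_eq_zero] at h
  exact h

/-- `E[S·Φₑ] = E|∇ₑS|²`: `∫ S·Φₑ·w = ∫ |∇ₑS|²·w`. [folklore] -/
theorem integral_action_mul_sdField (hS : ContDiff ℝ ∞ S) (hY : ∀ a, Y a ∈ suAlgebra n) (β : ℝ)
    (e : Edge d L) :
    ∫ U, S (coeConfig U) * sdField Y S β e (coeConfig U) * weight S β U
        ∂(trivialMeasure (Matrix.specialUnitaryGroup (Fin n) ℂ) d L) =
      ∫ U, sqGrad Y S e (coeConfig U) * weight S β U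
        ∂(trivialMeasure (Matrix.specialUnitaryGroup (Fin n) ℂ) d L) := by
  rw [integral_mul_sdField hS hS hY β e, ← integral_finsetSum _ (fun a _ =>
    integrable_mul_weight hS β ((contDiff_linkDeriv hS e (Y a)).mul (contDiff_linkDeriv hS e (Y a))))]
  refine integral_congr_ae (Filter.Eventually.of_forall fun U => ?_)
  show ∑ a, linkDeriv e (Y a) S (coeConfig U) * linkDeriv e (Y a) S (coeConfig U) * weight S β U =
    sqGrad Y S e (coeConfig U) * weight S β U
  unfold sqGrad
  rw [Finset.sum_mul]
  exact Finset.sum_congr rfl fun a _ => by ring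

/-- The link derivative of the Schwinger–Dyson field:
`∂_{e,X} Φ_{e'} = Σ_b (β·2 ∂'_bS · ∂_{e,X}∂'_bS − ∂_{e,X}∂'_b∂'_bS)`. [folklore] -/
theorem linkDeriv_sdField (hS : ContDiff ℝ ∞ S) (Y : ι → Matrix (Fin n) (Fin n) ℂ) (β : ℝ)
    (e' e : Edge d L) (X : Matrix (Fin n) (Fin n) ℂ) (W : AmbConfig d L n) :
    linkDeriv e X (sdField Y S β e') W =
      ∑ b, (β * (2 * linkDeriv e' (Y b) S W * linkDeriv e X (linkDeriv e' (Y b) S) W) -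
        linkDeriv e X (linkDeriv e' (Y b) (linkDeriv e' (Y b) S)) W) := by
  have h1 : ∀ b, ContDiff ℝ ∞ (linkDeriv e' (Y b) S) := fun b => contDiff_linkDeriv hS e' (Y b)
  have h2 : ∀ b, ContDiff ℝ ∞ (linkDeriv e' (Y b) (linkDeriv e' (Y b) S)) :=
    fun b => contDiff_linkDeriv (h1 b) e' (Y b)
  have hsum := congrFun (linkDeriv_finset_sum e X Finset.univ (sdTerm Y S β e')
    (fun b _ => contDiff_sdTerm hS Y β e' b)) W
  rw [sdField_eq_sum, hsum]
  refine Finset.sum_congr rfl fun b _ => ?_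
  have hsq : (fun W' => linkDeriv e' (Y b) S W' ^ 2) =
      fun W' => linkDeriv e' (Y b) S W' * linkDeriv e' (Y b) S W' := by
    funext W'; ring
  unfold sdTerm
  rw [linkDeriv_sub_of_differentiableAt e X
      ((contDiff_const.mul ((h1 b).pow 2)).differentiable (by simp) W)
      ((h2 b).differentiable (by simp) W),
    linkDeriv_const_mul' e X β (fun W' => linkDeriv e' (Y b) S W' ^ 2) W, hsq,
    linkDeriv_mul_of_differentiableAt e X ((h1 b).differentiable (by simp) W)
      ((h1 b).differentiable (by simp) W)]
  ring

/-- **Orthogonality of the Schwinger–Dyson fields of non-interacting links**: if `S` has no mixed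
`(e, e')` second and third derivatives along the family, then `∫ Φₑ'·Φₑ·w = 0`. [folklore] -/
theorem integral_sdField_mul_sdField_eq_zero (hS : ContDiff ℝ ∞ S) (hY : ∀ a, Y a ∈ suAlgebra n)
    (β : ℝ) {e e' : Edge d L}
    (hloc₁ : ∀ a b (W : AmbConfig d L n), linkDeriv e (Y a) (linkDeriv e' (Y b) S) W = 0)
    (hloc₂ : ∀ a b (W : AmbConfig d L n),
      linkDeriv e (Y a) (linkDeriv e' (Y b) (linkDeriv e' (Y b) S)) W = 0) :
    ∫ U, sdField Y S β e' (coeConfig U) * sdField Y S β e (coeConfig U) * weight S β U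
        ∂(trivialMeasure (Matrix.specialUnitaryGroup (Fin n) ℂ) d L) = 0 := by
  rw [integral_mul_sdField hS (contDiff_sdField hS Y β e') hY β e]
  refine Finset.sum_eq_zero fun a _ => ?_
  have hz : ∀ U : GaugeConfig d L (Matrix.specialUnitaryGroup (Fin n) ℂ),
      linkDeriv e (Y a) (sdField Y S β e') (coeConfig U) = 0 := fun U => by
    rw [linkDeriv_sdField hS]
    exact Finset.sum_eq_zero fun b _ => by rw [hloc₁, hloc₂]; ring
  simp [hz]

/-- **The second moment of `Φₑ` is bounded uniformly in `β > 0`**: with sup bounds `c₁, c₂, c₃` on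
the first, second, third `e`-derivatives of `S` along the family (`k = #ι`),
`∫ Φₑ²·w ≤ k²(2c₂² + c₁c₃)·∫ w`. [folklore] -/
theorem integral_sdField_sq_mul_weight_le (hS : ContDiff ℝ ∞ S) (hY : ∀ a, Y a ∈ suAlgebra n)
    {β c₁ c₂ c₃ : ℝ} (hβ : 0 < β) (hc₂ : 0 ≤ c₂) (e : Edge d L)
    (h₁ : ∀ (U : GaugeConfig d L (Matrix.specialUnitaryGroup (Fin n) ℂ)) a,
      |linkDeriv e (Y a) S (coeConfig U)| ≤ c₁)
    (h₂ : ∀ (U : GaugeConfig d L (Matrix.specialUnitaryGroup (Fin n) ℂ)) a b,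
      |linkDeriv e (Y a) (linkDeriv e (Y b) S) (coeConfig U)| ≤ c₂)
    (h₃ : ∀ (U : GaugeConfig d L (Matrix.specialUnitaryGroup (Fin n) ℂ)) a b,
      |linkDeriv e (Y a) (linkDeriv e (Y b) (linkDeriv e (Y b) S)) (coeConfig U)| ≤ c₃) :
    ∫ U, sdField Y S β e (coeConfig U) ^ 2 * weight S β U
        ∂(trivialMeasure (Matrix.specialUnitaryGroup (Fin n) ℂ) d L) ≤
      (Fintype.card ι : ℝ) ^ 2 * (2 * c₂ ^ 2 + c₁ * c₃) *
        ∫ U, weight S β U ∂(trivialMeasure (Matrix.specialUnitaryGroup (Fin n) ℂ) d L) := by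
  have hΦ : ContDiff ℝ ∞ (sdField Y S β e) := contDiff_sdField hS Y β e
  -- Step 1: `∫ Φ²w = Σ_a ∫ ∂_aΦ ∂_aS w = ∫ (Σ_a ∂_aS ∂_aΦ) w`.
  have hsq : (fun U : GaugeConfig d L (Matrix.specialUnitaryGroup (Fin n) ℂ) =>
      sdField Y S β e (coeConfig U) ^ 2 * weight S β U) = fun U =>
      sdField Y S β e (coeConfig U) * sdField Y S β e (coeConfig U) * weight S β U := by
    funext U; ring
  have step1 : ∫ U, sdField Y S β e (coeConfig U) ^ 2 * weight S β U
        ∂(trivialMeasure (Matrix.specialUnitaryGroup (Fin n) ℂ) d L) =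
      ∫ U, (∑ a, linkDeriv e (Y a) S (coeConfig U) *
        linkDeriv e (Y a) (sdField Y S β e) (coeConfig U)) * weight S β U
        ∂(trivialMeasure (Matrix.specialUnitaryGroup (Fin n) ℂ) d L) := by
    rw [hsq, integral_mul_sdField hS hΦ hY β e, ← integral_finsetSum _ (fun a _ =>
      integrable_mul_weight hS β ((contDiff_linkDeriv hΦ e (Y a)).mul (contDiff_linkDeriv hS e (Y a))))]
    refine integral_congr_ae (Filter.Eventually.of_forall fun U => ?_)
    show ∑ a, linkDeriv e (Y a) (sdField Y S β e) (coeConfig U) * linkDeriv e (Y a) S (coeConfig U) *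
        weight S β U = (∑ a, linkDeriv e (Y a) S (coeConfig U) *
        linkDeriv e (Y a) (sdField Y S β e) (coeConfig U)) * weight S β U
    rw [Finset.sum_mul]
    exact Finset.sum_congr rfl fun a _ => by ring
  -- Step 2: the pointwise bound `Σ_a ∂_aS ∂_aΦ ≤ 2βc₂k |∇S|² + k²c₁c₃`.
  have step2 : ∀ U : GaugeConfig d L (Matrix.specialUnitaryGroup (Fin n) ℂ),
      (∑ a, linkDeriv e (Y a) S (coeConfig U) * linkDeriv e (Y a) (sdField Y S β e) (coeConfig U)) *
        weight S β U ≤ (2 * β * c₂ * Fintype.card ι * sqGrad Y S e (coeConfig U) +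
          (Fintype.card ι : ℝ) ^ 2 * (c₁ * c₃)) * weight S β U := by
    intro U
    refine mul_le_mul_of_nonneg_right ?_ (weight_pos S β U).le
    have key := sum_mul_sum_le (fun a => linkDeriv e (Y a) S (coeConfig U))
      (fun a b => linkDeriv e (Y a) (linkDeriv e (Y b) S) (coeConfig U))
      (fun a b => linkDeriv e (Y a) (linkDeriv e (Y b) (linkDeriv e (Y b) S)) (coeConfig U))
      hβ.le hc₂ (h₁ U) (h₂ U) (h₃ U)
    have hre : ∀ a, linkDeriv e (Y a) (sdField Y S β e) (coeConfig U) =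
        ∑ b, (β * (2 * linkDeriv e (Y b) S (coeConfig U) *
          linkDeriv e (Y a) (linkDeriv e (Y b) S) (coeConfig U)) -
          linkDeriv e (Y a) (linkDeriv e (Y b) (linkDeriv e (Y b) S)) (coeConfig U)) :=
      fun a => linkDeriv_sdField hS Y β e e (Y a) (coeConfig U)
    simp only [hre]
    unfold sqGrad
    exact key
  -- Step 3: integrate; `β ∫ |∇S|² w = ∫ ΔS w ≤ k c₂ ∫ w`.
  have I6 : Integrable (fun U => (∑ a, linkDeriv e (Y a) S (coeConfig U) *
      linkDeriv e (Y a) (sdField Y S β e) (coeConfig U)) * weight S β U)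
      (trivialMeasure (Matrix.specialUnitaryGroup (Fin n) ℂ) d L) :=
    integrable_mul_weight hS β (F := fun W => ∑ a, linkDeriv e (Y a) S W *
      linkDeriv e (Y a) (sdField Y S β e) W)
      (ContDiff.sum fun a _ => (contDiff_linkDeriv hS e (Y a)).mul (contDiff_linkDeriv hΦ e (Y a)))
  have I7 : Integrable (fun U => (2 * β * c₂ * Fintype.card ι * sqGrad Y S e (coeConfig U) +
      (Fintype.card ι : ℝ) ^ 2 * (c₁ * c₃)) * weight S β U)
      (trivialMeasure (Matrix.specialUnitaryGroup (Fin n) ℂ) d L) :=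
    integrable_mul_weight hS β (F := fun W => 2 * β * c₂ * Fintype.card ι * sqGrad Y S e W +
      (Fintype.card ι : ℝ) ^ 2 * (c₁ * c₃))
      ((contDiff_const.mul (contDiff_sqGrad hS Y e)).add contDiff_const)
  have step3 := integral_mono I6 I7 step2
  have hsplit : ∫ U, (2 * β * c₂ * Fintype.card ι * sqGrad Y S e (coeConfig U) +
      (Fintype.card ι : ℝ) ^ 2 * (c₁ * c₃)) * weight S β U
        ∂(trivialMeasure (Matrix.specialUnitaryGroup (Fin n) ℂ) d L) =
      2 * c₂ * Fintype.card ι * (β * ∫ U, sqGrad Y S e (coeConfig U) * weight S β U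
        ∂(trivialMeasure (Matrix.specialUnitaryGroup (Fin n) ℂ) d L)) +
      (Fintype.card ι : ℝ) ^ 2 * (c₁ * c₃) *
        ∫ U, weight S β U ∂(trivialMeasure (Matrix.specialUnitaryGroup (Fin n) ℂ) d L) := by
    have hpt : (fun U : GaugeConfig d L (Matrix.specialUnitaryGroup (Fin n) ℂ) =>
        (2 * β * c₂ * Fintype.card ι * sqGrad Y S e (coeConfig U) +
        (Fintype.card ι : ℝ) ^ 2 * (c₁ * c₃)) * weight S β U) = fun U =>
        (2 * c₂ * Fintype.card ι * β) * (sqGrad Y S e (coeConfig U) * weight S β U) +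
        (Fintype.card ι : ℝ) ^ 2 * (c₁ * c₃) * weight S β U := by
      funext U; ring
    rw [hpt, integral_add (((integrable_mul_weight hS β (contDiff_sqGrad hS Y e))).const_mul _)
      ((integrable_trivialMeasure_of_continuous (continuous_weight hS β)).const_mul _),
      integral_const_mul, integral_const_mul]
    ring
  have hlap : ∫ U, dirLap Y S e (coeConfig U) * weight S β U
        ∂(trivialMeasure (Matrix.specialUnitaryGroup (Fin n) ℂ) d L) ≤
      Fintype.card ι * c₂ *
        ∫ U, weight S β U ∂(trivialMeasure (Matrix.specialUnitaryGroup (Fin n) ℂ) d L) := by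
    rw [← integral_const_mul]
    refine integral_mono (integrable_mul_weight hS β (contDiff_dirLap hS Y e))
      ((integrable_trivialMeasure_of_continuous (continuous_weight hS β)).const_mul _) fun U => ?_
    refine mul_le_mul_of_nonneg_right ?_ (weight_pos S β U).le
    unfold dirLap
    calc ∑ a, linkDeriv e (Y a) (linkDeriv e (Y a) S) (coeConfig U)
        ≤ ∑ a, |linkDeriv e (Y a) (linkDeriv e (Y a) S) (coeConfig U)| :=
          Finset.sum_le_sum fun a _ => le_abs_self _
      _ ≤ ∑ _a : ι, c₂ := Finset.sum_le_sum fun a _ => h₂ U a a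
      _ = Fintype.card ι * c₂ := by rw [Finset.sum_const, Finset.card_univ, nsmul_eq_mul]
  rw [step1]
  refine step3.trans ?_
  rw [hsplit, integral_dirLap_mul_weight hS hY β e]
  have hZ := (integral_weight_pos hS β (d := d) (L := L) (n := n)).le
  have hk : (0 : ℝ) ≤ Fintype.card ι := Nat.cast_nonneg _
  nlinarith [mul_le_mul_of_nonneg_left hlap (by positivity : (0:ℝ) ≤ 2 * c₂ * Fintype.card ι)]

end Family

end Summit.Ventures.LatticeQCDFlow.Theory2.SchwingerDyson
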